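import Literature.Analysis.Calculus.HadamardDivisionLast     -- ★ `lastQuot`, `eq_smul_lastQuot`, `contDiff_lastQuot` (Hadamard division in the last coordinate, with parameters)
import HarnessLib

/-!
# An `S₃`-ALTERNATING smooth function of three real variables is the Vandermonde product times a SYMMETRIC smooth function (Hadamard's lemma across the three walls;
# with parameters and Banach values) — the division half of the class-function realisation at a scalar corner (Glaeser 1963; folklore)

Topic `Analysis/Calculus`; namespace `Literature.Analysis.Calculus`.  THEOREMS ONLY (no `def`, no instance, no notation, no axiom, no named fact, no `sorry`); Mathlib + ★ `HadamardDivisionLast`.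
Cell `pub/hodgecm-mathlib`, crux H413 (`stmt-HodgeConjecture-24833`), road «N8-INNER» (row 2 `stub_N8`), ROAD B brick (10) «CORNER EP GENERATOR», package **(C′) «Hadamard ×3»** (dealer LH2-plan
(g1) 2026-09-02T16:17:17Z «(C′) Hadamard ×3 goes to the next free hand»; seat LH10-p02 (g9)).  Its consumer composes it with ★ Glaeser-`S₃` `exists_contDiff_comp_esymm_three_of_forall_perm`
(p851824): at a scalar corner the twisted stable family is `S₃`-ANTIsymmetric in the three eigen-angles, so it is `Δ ·` (a smooth SYMMETRIC germ) `= Δ · (F ∘ esymm)`.  Count-neutral.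

THE RESULT **`exists_contDiff_symm_vandermonde_smul_of_alternating`**: for `U : (Fin 3 → ℝ) × P → E` of class `C^∞` (`P` a finite-dimensional real parameter space, `E` Banach) with
`U (x ∘ σ, z) = sign σ • U (x, z)` for every `σ ∈ S₃`, there is a `C^∞` function `V`, SYMMETRIC (`V (x ∘ σ, z) = V (x, z)`), with
**`U (x, z) = ((x 0 − x 1) * (x 0 − x 2) * (x 1 − x 2)) • V (x, z)`** for all `x, z`.
PROOF.  §1 ONE WALL: a `C^∞` function vanishing on the wall `{x i = x j}` is `(x i − x j) •` (a `C^∞` function) — ★ `eq_smul_lastQuot`∕`contDiff_lastQuot` after the affine change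
`t = x i − x j` (the quotient is `lastQuot` of `U` pulled back along `(w, t) ↦ w + ((t − (w i − w j))∕2)·(e_i − e_j)`, written inline).  §2 DENSITY: if `(x i − x j) • U₁` vanishes on ANOTHER wall `{x k = x l}`
then so does `U₁` (off `{x i = x j}` divide; on it, approach along the wall in the direction `e_m`, `m ∈ {i, j} ∖ {k, l}`, and use continuity).  §3 an alternating `U` vanishes on the three
walls, so `U = (x₀−x₁) • U₁`, `U₁ = (x₀−x₂) • U₂`, `U₂ = (x₁−x₂) • U₃`; §4 SYMMETRISATION: `V := (1∕6) Σ_σ U₃ ∘ σ` is symmetric and still satisfies `U = Δ • V` because `Δ (x ∘ σ) = sign σ · Δ x`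
and `U` is alternating — no second density argument.
HONEST LABEL: calculus plumbing; HC_CM is proved only modulo the 7 printed citations (2 remaining: hLiu418 = stmt-HodgeConjecture-24832, h413 = stmt-HodgeConjecture-24833) until rung 0 closes.

## References
* [Glaeser1963Newton] G. Glaeser, *Fonctions composées différentiables*, Ann. of Math. 77 (1963) 193–209, Thm. II (the symmetric case; the alternating case reduces to it by this division).
* [Milnor1963] J. Milnor, *Morse Theory* (1963), Lemma 2.1 (Hadamard's lemma).
-/

set_option autoImplicit false

noncomputable section

open Set Function Filter Topology
open scoped ContDiff

namespace Literature.Analysis.Calculus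

variable {P : Type*} [NormedAddCommGroup P] [NormedSpace ℝ P] [FiniteDimensional ℝ P]
  {E : Type*} [NormedAddCommGroup E] [NormedSpace ℝ E] [CompleteSpace E]

/-! ## §1 Hadamard across one wall `{x i = x j}` -/

/-- **HADAMARD ACROSS ONE WALL, WITH PARAMETERS**: a `C^∞` function `U : (Fin 3 → ℝ) × P → E` vanishing on the wall `{x i = x j}` (`i ≠ j`) is `(x i − x j) • U₁` with `U₁` `C^∞`.
[cite: Milnor1963, Lemma 2.1] -/
theorem exists_contDiff_sub_smul_of_wall {i j : Fin 3} (hij : i ≠ j) (U : (Fin 3 → ℝ) × P → E) (hU : ContDiff ℝ ∞ U)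
    (h0 : ∀ (x : Fin 3 → ℝ) (z : P), x i = x j → U (x, z) = 0) :
    ∃ U₁ : (Fin 3 → ℝ) × P → E, ContDiff ℝ ∞ U₁ ∧ ∀ (x : Fin 3 → ℝ) (z : P), U (x, z) = (x i - x j) • U₁ (x, z) := by
  -- pull `U` back along the affine chart `((w, z), t) ↦ (w + ((t − (w i − w j))/2) • (e_i − e_j), z)`
  set v : Fin 3 → ℝ := (Pi.single i (1 : ℝ) : Fin 3 → ℝ) - Pi.single j (1 : ℝ) with hv
  set L : ((Fin 3 → ℝ) × P) × ℝ → (Fin 3 → ℝ) × P :=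
    fun q => (q.1.1 + ((q.2 - (q.1.1 i - q.1.1 j)) / 2) • v, q.1.2) with hL
  have hLs : ContDiff ℝ ∞ L := by
    refine ContDiff.prodMk ?_ (contDiff_snd.comp contDiff_fst)
    have hcoef : ContDiff ℝ ∞ fun q : ((Fin 3 → ℝ) × P) × ℝ => (q.2 - (q.1.1 i - q.1.1 j)) / 2 :=
      (contDiff_snd.sub (((contDiff_apply ℝ ℝ i).comp (contDiff_fst.comp contDiff_fst)).sub
        ((contDiff_apply ℝ ℝ j).comp (contDiff_fst.comp contDiff_fst)))).div_const 2
    exact (contDiff_fst.comp contDiff_fst).add (hcoef.smul contDiff_const)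
  set g : ((Fin 3 → ℝ) × P) × ℝ → E := fun q => U (L q) with hg
  have hgs : ContDiff ℝ ∞ g := hU.comp hLs
  -- `g` vanishes at `t = 0`: the chart point lies on the wall
  have hg0 : ∀ w : (Fin 3 → ℝ) × P, g (w, 0) = 0 := by
    intro w
    simp only [hg, hL]
    apply h0
    simp only [hv, Pi.add_apply, Pi.smul_apply, Pi.sub_apply, Pi.single_eq_same, Pi.single_eq_of_ne hij.symm, Pi.single_eq_of_ne hij, smul_eq_mul]
    ring
  -- Hadamard in the last coordinate
  have hHad : ∀ q, g q = q.2 • lastQuot g q := eq_smul_lastQuot (hgs.of_le (by exact_mod_cast le_top)) hg0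
  have hQs : ContDiff ℝ ∞ (lastQuot g) := contDiff_lastQuot (n := (⊤ : ℕ∞)) (by exact_mod_cast hgs)
  -- at `t = x i − x j` the chart point is `(x, z)` itself
  have hLx : ∀ (x : Fin 3 → ℝ) (z : P), L ((x, z), x i - x j) = (x, z) := by
    intro x z
    simp only [hL, sub_self, zero_div, zero_smul, add_zero]
  refine ⟨fun p => lastQuot g (p, p.1 i - p.1 j), ?_, fun x z => ?_⟩
  · exact hQs.comp (contDiff_id.prodMk (((contDiff_apply ℝ ℝ i).comp contDiff_fst).sub ((contDiff_apply ℝ ℝ j).comp contDiff_fst)))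
  · have h := hHad ((x, z), x i - x j)
    simp only [hg, hLx] at h
    exact h

/-! ## §2 Division does not destroy vanishing on the other walls -/

/-- For two distinct walls `{i, j} ≠ {k, l}` of `Fin 3` (`i ≠ j`, `k ≠ l`) there is an index in `{i, j}` outside `{k, l}`. [cite: Glaeser1963Newton, Thm. II] -/
theorem exists_mem_pair_not_mem_pair {i j k l : Fin 3} (hij : i ≠ j) (hkl : k ≠ l) (hne : ¬((i = k ∧ j = l) ∨ (i = l ∧ j = k))) :
    ∃ m : Fin 3, (m = i ∨ m = j) ∧ m ≠ k ∧ m ≠ l := by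
  revert i j k l
  decide

omit [NormedSpace ℝ P] [FiniteDimensional ℝ P] [CompleteSpace E] in
/-- **DENSITY STEP**: if `U₁` is continuous and `(x i − x j) • U₁` vanishes on the wall `{x k = x l}` (a DIFFERENT wall), then `U₁` vanishes on that wall (divide off `{x i = x j}`; on it,
approach along the wall in the direction `e_m`, `m ∈ {i, j} ∖ {k, l}`). [cite: Glaeser1963Newton, Thm. II] -/
theorem eq_zero_on_wall_of_sub_smul_eq_zero {i j k l : Fin 3} (hij : i ≠ j) (hkl : k ≠ l) (hne : ¬((i = k ∧ j = l) ∨ (i = l ∧ j = k)))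
    {U₁ : (Fin 3 → ℝ) × P → E} (hU₁ : Continuous U₁) (h0 : ∀ (x : Fin 3 → ℝ) (z : P), x k = x l → (x i - x j) • U₁ (x, z) = 0) :
    ∀ (x : Fin 3 → ℝ) (z : P), x k = x l → U₁ (x, z) = 0 := by
  intro x z hx
  by_cases hxij : x i = x j
  · -- approach along the wall
    obtain ⟨m, hm, hmk, hml⟩ := exists_mem_pair_not_mem_pair hij hkl hne
    set em : Fin 3 → ℝ := Pi.single m (1 : ℝ) with hem
    set γ : ℝ → (Fin 3 → ℝ) × P := fun ε => (x + ε • em, z) with hγ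
    have hγc : Continuous γ := (continuous_const.add (continuous_id.smul continuous_const)).prodMk continuous_const
    have hγ0 : γ 0 = (x, z) := by simp [hγ]
    -- off `ε = 0` the curve stays on the wall `{x k = x l}` and leaves `{x i = x j}`, so `U₁ ∘ γ = 0` there
    have hzero : ∀ ε : ℝ, ε ≠ 0 → U₁ (γ ε) = 0 := by
      intro ε hε
      have hwall : (x + ε • em) k = (x + ε • em) l := by
        simp only [Pi.add_apply, Pi.smul_apply, hem, Pi.single_eq_of_ne hmk.symm, Pi.single_eq_of_ne hml.symm, smul_zero, add_zero, hx]
      have h := h0 (x + ε • em) z hwall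
      have hdiff : (x + ε • em) i - (x + ε • em) j ≠ 0 := by
        rcases hm with rfl | rfl
        · simp only [Pi.add_apply, Pi.smul_apply, hem, Pi.single_eq_same, Pi.single_eq_of_ne hij.symm, smul_eq_mul, mul_one, mul_zero, add_zero, hxij]
          intro h'; apply hε; linarith
        · simp only [Pi.add_apply, Pi.smul_apply, hem, Pi.single_eq_same, Pi.single_eq_of_ne hij, smul_eq_mul, mul_one, mul_zero, add_zero, hxij]
          intro h'; apply hε; linarith
      exact (smul_eq_zero.1 h).resolve_left hdiff
    -- continuity at `ε = 0` along the punctured neighbourhood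
    have hlim : Tendsto (fun ε : ℝ => U₁ (γ ε)) (𝓝[≠] (0 : ℝ)) (𝓝 (U₁ (x, z))) := by
      have h := (hU₁.comp hγc).continuousAt (x := (0 : ℝ))
      rw [ContinuousAt, Function.comp_apply, hγ0] at h
      exact h.mono_left nhdsWithin_le_nhds
    have hconst : Tendsto (fun ε : ℝ => U₁ (γ ε)) (𝓝[≠] (0 : ℝ)) (𝓝 0) := by
      refine (tendsto_const_nhds (x := (0 : E))).congr' ?_
      filter_upwards [self_mem_nhdsWithin] with ε hε
      exact (hzero ε hε).symm
    exact tendsto_nhds_unique hlim hconst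
  · have h := h0 x z hx
    exact (smul_eq_zero.1 h).resolve_left (sub_ne_zero.2 hxij)

/-! ## §3 Alternating functions: the Vandermonde division -/

omit [NormedAddCommGroup P] [NormedSpace ℝ P] [FiniteDimensional ℝ P] [CompleteSpace E] in
/-- An alternating function vanishes on every wall. [cite: Glaeser1963Newton, Thm. II] -/
theorem eq_zero_on_wall_of_alternating {i j : Fin 3} (hij : i ≠ j) {U : (Fin 3 → ℝ) × P → E}
    (halt : ∀ (σ : Equiv.Perm (Fin 3)) (x : Fin 3 → ℝ) (z : P), U (x ∘ σ, z) = ((Equiv.Perm.sign σ : ℤ) : ℝ) • U (x, z)) :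
    ∀ (x : Fin 3 → ℝ) (z : P), x i = x j → U (x, z) = 0 := by
  intro x z hx
  have hfix : x ∘ (Equiv.swap i j) = x := by
    funext k
    simp only [Function.comp_apply]
    by_cases hki : k = i
    · subst hki; rw [Equiv.swap_apply_left, hx]
    · by_cases hkj : k = j
      · subst hkj; rw [Equiv.swap_apply_right, hx]
      · rw [Equiv.swap_apply_of_ne_of_ne hki hkj]
  have h := halt (Equiv.swap i j) x z
  rw [hfix, Equiv.Perm.sign_swap hij, Units.val_neg, Units.val_one, Int.cast_neg, Int.cast_one, neg_one_smul] at h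
  -- `U = −U`
  have h2 : (2 : ℝ) • U (x, z) = 0 := by rw [two_smul]; nth_rewrite 1 [h]; exact neg_add_cancel _
  exact (smul_eq_zero.1 h2).resolve_left two_ne_zero

/-- The Vandermonde product is alternating under transpositions: for a transposition `τ` of `Fin 3`, `Δ (x ∘ τ) = −Δ x`, `Δ x = (x 0 − x 1)(x 0 − x 2)(x 1 − x 2)`.
[cite: Glaeser1963Newton, Thm. II] -/
theorem vandermonde3_comp_swap (x : Fin 3 → ℝ) {a b : Fin 3} (hab : a ≠ b) :
    ((x ∘ Equiv.swap a b) 0 - (x ∘ Equiv.swap a b) 1) * ((x ∘ Equiv.swap a b) 0 - (x ∘ Equiv.swap a b) 2) * ((x ∘ Equiv.swap a b) 1 - (x ∘ Equiv.swap a b) 2) =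
      -((x 0 - x 1) * (x 0 - x 2) * (x 1 - x 2)) := by
  fin_cases a <;> fin_cases b
  all_goals first | exact absurd rfl hab | (simp [Equiv.swap_apply_def]; ring)

/-- **`Δ (x ∘ σ) = sign σ · Δ x`** for every `σ ∈ S₃`. [cite: Glaeser1963Newton, Thm. II] -/
theorem vandermonde3_comp_perm (x : Fin 3 → ℝ) (σ : Equiv.Perm (Fin 3)) :
    ((x ∘ σ) 0 - (x ∘ σ) 1) * ((x ∘ σ) 0 - (x ∘ σ) 2) * ((x ∘ σ) 1 - (x ∘ σ) 2) = ((Equiv.Perm.sign σ : ℤ) : ℝ) * ((x 0 - x 1) * (x 0 - x 2) * (x 1 - x 2)) := by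
  induction σ using Equiv.Perm.swap_induction_on' generalizing x with
  | one => simp
  | mul_swap f a b hab ih =>
    have hcomp : (x ∘ ⇑(f * Equiv.swap a b)) = ((x ∘ ⇑f) ∘ ⇑(Equiv.swap a b)) := by funext k; simp
    rw [hcomp, vandermonde3_comp_swap _ hab, ih, Equiv.Perm.sign_mul, Equiv.Perm.sign_swap hab]
    push_cast
    ring

/-- **AN ALTERNATING `C^∞` FUNCTION IS A VANDERMONDE MULTIPLE** (no symmetry of the quotient claimed yet): `U = Δ • U₃` with `U₃` `C^∞` — Hadamard across `{x₀ = x₁}`, then `{x₀ = x₂}`,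
then `{x₁ = x₂}`, the vanishing on the later walls surviving each division by §2. [cite: Glaeser1963Newton, Thm. II] [cite: Milnor1963, Lemma 2.1] -/
theorem exists_contDiff_vandermonde_smul_of_alternating (U : (Fin 3 → ℝ) × P → E) (hU : ContDiff ℝ ∞ U)
    (halt : ∀ (σ : Equiv.Perm (Fin 3)) (x : Fin 3 → ℝ) (z : P), U (x ∘ σ, z) = ((Equiv.Perm.sign σ : ℤ) : ℝ) • U (x, z)) :
    ∃ U₃ : (Fin 3 → ℝ) × P → E, ContDiff ℝ ∞ U₃ ∧ ∀ (x : Fin 3 → ℝ) (z : P), U (x, z) = ((x 0 - x 1) * (x 0 - x 2) * (x 1 - x 2)) • U₃ (x, z) := by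
  have h01 : (0 : Fin 3) ≠ 1 := by decide
  have h02 : (0 : Fin 3) ≠ 2 := by decide
  have h12 : (1 : Fin 3) ≠ 2 := by decide
  -- wall `{x₀ = x₁}`
  obtain ⟨U₁, hU₁, hU₁eq⟩ := exists_contDiff_sub_smul_of_wall h01 U hU (eq_zero_on_wall_of_alternating h01 halt)
  -- `U₁` vanishes on `{x₀ = x₂}` and `{x₁ = x₂}`
  have hU₁02 : ∀ (x : Fin 3 → ℝ) (z : P), x 0 = x 2 → U₁ (x, z) = 0 :=
    eq_zero_on_wall_of_sub_smul_eq_zero h01 h02 (by decide) hU₁.continuous fun x z hx => by rw [← hU₁eq]; exact eq_zero_on_wall_of_alternating h02 halt x z hx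
  have hU₁12 : ∀ (x : Fin 3 → ℝ) (z : P), x 1 = x 2 → U₁ (x, z) = 0 :=
    eq_zero_on_wall_of_sub_smul_eq_zero h01 h12 (by decide) hU₁.continuous fun x z hx => by rw [← hU₁eq]; exact eq_zero_on_wall_of_alternating h12 halt x z hx
  -- wall `{x₀ = x₂}`
  obtain ⟨U₂, hU₂, hU₂eq⟩ := exists_contDiff_sub_smul_of_wall h02 U₁ hU₁ hU₁02
  have hU₂12 : ∀ (x : Fin 3 → ℝ) (z : P), x 1 = x 2 → U₂ (x, z) = 0 :=
    eq_zero_on_wall_of_sub_smul_eq_zero h02 h12 (by decide) hU₂.continuous fun x z hx => by rw [← hU₂eq]; exact hU₁12 x z hx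
  -- wall `{x₁ = x₂}`
  obtain ⟨U₃, hU₃, hU₃eq⟩ := exists_contDiff_sub_smul_of_wall h12 U₂ hU₂ hU₂12
  refine ⟨U₃, hU₃, fun x z => ?_⟩
  rw [hU₁eq, hU₂eq, hU₃eq, smul_smul, smul_smul]

/-! ## §4 Symmetrisation of the quotient -/

omit [FiniteDimensional ℝ P] [CompleteSpace E] in
/-- Composition with a slot permutation is `C^∞` (linear in the first factor). [cite: Glaeser1963Newton, Thm. II] -/
theorem contDiff_comp_perm_prod (σ : Equiv.Perm (Fin 3)) : ContDiff ℝ ∞ fun p : (Fin 3 → ℝ) × P => ((p.1 ∘ σ, p.2) : (Fin 3 → ℝ) × P) :=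
  (contDiff_pi.2 fun k => (contDiff_apply ℝ ℝ (σ k)).comp contDiff_fst).prodMk contDiff_snd

/-- **AN `S₃`-ALTERNATING `C^∞` FUNCTION IS THE VANDERMONDE PRODUCT TIMES A SYMMETRIC `C^∞` FUNCTION** (with parameters, Banach values): `U (x, z) = Δ(x) • V (x, z)`, `V` `C^∞` and
`V (x ∘ σ, z) = V (x, z)` for all `σ ∈ S₃` — §3 plus the symmetrisation `V := (1∕6) Σ_σ U₃ (x ∘ σ, z)`, which still divides `U` because `Δ (x ∘ σ) = sign σ · Δ x` and `U` is alternating.  The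
quotient `V` then factors through `(e₁, e₂, e₃)` by ★ Glaeser-`S₃` `exists_contDiff_comp_esymm_three_of_forall_perm`. [cite: Glaeser1963Newton, Thm. II] [cite: Milnor1963, Lemma 2.1] -/
theorem exists_contDiff_symm_vandermonde_smul_of_alternating (U : (Fin 3 → ℝ) × P → E) (hU : ContDiff ℝ ∞ U)
    (halt : ∀ (σ : Equiv.Perm (Fin 3)) (x : Fin 3 → ℝ) (z : P), U (x ∘ σ, z) = ((Equiv.Perm.sign σ : ℤ) : ℝ) • U (x, z)) :
    ∃ V : (Fin 3 → ℝ) × P → E, ContDiff ℝ ∞ V ∧ (∀ (σ : Equiv.Perm (Fin 3)) (x : Fin 3 → ℝ) (z : P), V (x ∘ σ, z) = V (x, z)) ∧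
      ∀ (x : Fin 3 → ℝ) (z : P), U (x, z) = ((x 0 - x 1) * (x 0 - x 2) * (x 1 - x 2)) • V (x, z) := by
  obtain ⟨U₃, hU₃, hU₃eq⟩ := exists_contDiff_vandermonde_smul_of_alternating U hU halt
  refine ⟨fun p => (6 : ℝ)⁻¹ • ∑ σ : Equiv.Perm (Fin 3), U₃ (p.1 ∘ σ, p.2), ?_, ?_, fun x z => ?_⟩
  · exact contDiff_const.smul (ContDiff.sum fun σ _ => hU₃.comp (contDiff_comp_perm_prod σ))
  · intro σ x z
    simp only
    congr 1
    -- reindex the sum by right multiplication with `σ`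
    have h : ∑ τ : Equiv.Perm (Fin 3), U₃ ((x ∘ σ) ∘ τ, z) = ∑ τ : Equiv.Perm (Fin 3), U₃ (x ∘ ⇑(σ * τ), z) := by
      refine Finset.sum_congr rfl fun τ _ => ?_
      rfl
    rw [h]
    exact Fintype.sum_equiv (Equiv.mulLeft σ) _ _ fun τ => rfl
  · -- `Δ • V = (1/6) Σ_σ Δ(x) • U₃(x∘σ) = (1/6) Σ_σ sign σ • U(x ∘ σ) = (1/6) Σ_σ U x = U x`
    have hterm : ∀ σ : Equiv.Perm (Fin 3), ((x 0 - x 1) * (x 0 - x 2) * (x 1 - x 2)) • U₃ (x ∘ σ, z) = U (x, z) := by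
      intro σ
      have hsq : ((Equiv.Perm.sign σ : ℤ) : ℝ) * ((Equiv.Perm.sign σ : ℤ) : ℝ) = 1 := by
        rcases Int.units_eq_one_or (Equiv.Perm.sign σ) with h | h <;> simp [h]
      have h1 : ((x 0 - x 1) * (x 0 - x 2) * (x 1 - x 2)) = ((Equiv.Perm.sign σ : ℤ) : ℝ) * (((x ∘ σ) 0 - (x ∘ σ) 1) * ((x ∘ σ) 0 - (x ∘ σ) 2) * ((x ∘ σ) 1 - (x ∘ σ) 2)) := by
        rw [vandermonde3_comp_perm, ← mul_assoc, hsq, one_mul]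
      rw [h1, mul_smul, ← hU₃eq (x ∘ σ) z, halt σ x z, smul_smul, hsq, one_smul]
    show U (x, z) = ((x 0 - x 1) * (x 0 - x 2) * (x 1 - x 2)) • ((6 : ℝ)⁻¹ • ∑ σ : Equiv.Perm (Fin 3), U₃ (x ∘ σ, z))
    rw [smul_comm, Finset.smul_sum]
    simp only [hterm, Finset.sum_const, Finset.card_univ, Fintype.card_perm, Fintype.card_fin]
    rw [← Nat.cast_smul_eq_nsmul ℝ, smul_smul]
    norm_num [Nat.factorial]

end Literature.Analysis.Calculus

end
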